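import Summits.QuantumFields.BalabanUV.T4Continuum.Support.VectorGaugeCovarianceEffective
import Summits.QuantumFields.BalabanUV.T4Continuum.Support.VariationalVectorOneStepPhys

/-!
# T⁴ programme, spine node NE2 (U1a), lane P2 — «V-GAUGE-COV», file 4: THE DISPLAYED BINDERS OF THE VECTOR END ARE GAUGE-INVARIANT STATEMENTS, AND THE
# GAUGE-ORBIT TRANSFER OF THE MONOTONE END's CONCLUSION (model level; cell `pub-balaban`)

NE2 formalisation swarm `b2b-balaban-t4-ne2-formalise-*`, leaf prover 03 GEN 7 (`prover-b2b-balaban-t4-ne2-formalise-leaf-03-g7-0`); register row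
«P2-sup» of `t4/formal/NE2/LEAVES.md`; journal INTENT «V-GAUGE-COV» CLAIMS.log l.19543.  On top of files 1 ∕ 1b ∕ 2 ∕ 3 (`VectorGaugeCovariance*`) BY NAME.
 * §1 (general Hilbert `E`) the per-level binders of `VariationalVectorEndMonotone.effV_tendsto_of_upper` (p226720) ∕ `…TaxiTowerProjG.effV_tendsto_taxiTower_projG_of_class`
   (p229644) TRANSFER along a gauge transformation `(v, u, u′)` of the two-level data `(R, T, G ; R′, T′, G′)`: **`hUBc_gauge`** (V-UB), **`hPc_gauge`** (V-P),
   **`hGdiv_gauge`** ((GF3)), **`hREG_gauge`** (V-REG, `ρ = rhoV`), **`hONEm_gauge`** ((ONE-min)) — each binder for the presented data implies the same binder,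
   same constants, for the gauged data `R^u`, `T^g = gaugeL v u T`, `G^u = G ∘ gaugeW u⋆`, `R′^{u′}`, `T′^g = gaugeL u u′ T′`, `G′^{u′}`.
 * §2 (`E = ℂ`) **`blockSpin_gauge`**: `blockSpin (QvL T^g) (ScV R^u G^u) (v·φ) = blockSpin (QvL T) (ScV R G) φ`;
   **`effV_limit_of_gauge`** — THE GAUGE-ORBIT TRANSFER: along ANY family of unitary site fields `u k` (level `k`) and `v` (unit lattice), if the monotone END's
   CONCLUSION holds for the gauged tower (`∃ X∞`, convergence of `effV (L^k) M (R^u k) (U_k Gm_k U_kᴴ) (QmL (T^g k)) a`, Hermitian nonnegative limit, convergence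
   of the block-spin values), then it holds for the presented tower with `X∞ ↦ Vᴴ X∞ V` (`V = phaseM M v`).  So every END whose hypotheses are verified in SOME
   gauge (e.g. the regular-class capstones of `ProjGDivControlRegular` ∕ `DivControlCovariantFrames` and their tower assembly) concludes for every presentation of the
   same orbit: «regular PRESENTATION» weakens to «regular up to a lattice gauge transformation».  NO coherence of the `u k` across levels is needed for the transfer
   itself (the unit-lattice rotation `v` is the only one the effective operators see); coherence enters only when the gauged tower's own `hTcomp` ∕ `hRtr` are
   wanted (file 1b's `compL_gauge` ∕ `Rtrv_gauge`).

HONEST FRAMING (T4-DAG p. 1).  Model level (c5: operators ∕ frames ∕ carriers DATA; no identification with Bałaban's `U`, no B0); [folklore] bookkeeping, NO analytic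
content; the EXISTENCE of a regular gauge for small-curvature data ([Balaban1985RegularGauge] ∕ node NE3) is NOT claimed; no `def`, no `def … : Prop`, no `sorry`; axioms
standard.  V-END with background ∕ NE2 NOT proved; NE3 OPEN; spine PROVED 0∕9 unchanged; rung (B)+1 on a fixed finite T⁴ — NOT infinite volume, NOT mass gap, NOT
Clay.  HONEST DEPENDENCY (cell, verbatim): continuum YM on T⁴ ⇐ BetaPertH ∧ nine spine estimates (0/9 proved); BetaPertH ⇐ (D1) ∧ (D4) ∧ CAP+tail; G-an2-4
gates asym, D1 and NE2/3/4.
-/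

noncomputable section

namespace Summit.QuantumFields.BalabanUV.T4Continuum.VectorGaugeCovariance

open Finset Matrix Filter
open scoped BigOperators Matrix ComplexConjugate ComplexOrder Topology
open Literature.MathematicalPhysics.QuantumFieldTheory.Balaban1983to89.B5Prop11Plancherel (Tor fine unitVec)
open Literature.Analysis.Complex (qform qform_conj)
open Summit.QuantumFields.BalabanUV.T4Continuum.VariationalTransfer (blockSpin)
open Summit.QuantumFields.BalabanUV.T4Continuum.VectorBlockTrialForm (nsqV QvL)
open Summit.QuantumFields.BalabanUV.T4Continuum.VariationalVectorForm (ScV SfV qWV)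
open Summit.QuantumFields.BalabanUV.T4Continuum.VariationalVectorWeitzenbock (divSq)
open Summit.QuantumFields.BalabanUV.T4Continuum.VariationalVectorOneStepPhys (rhoV)
open Summit.QuantumFields.BalabanUV.T4Continuum.VariationalVectorEffective (unc cur unc_cur cur_unc effV blockSpin_relabel)
open Summit.QuantumFields.BalabanUV.T4Continuum.VariationalVectorTower (QmL)

variable {d : ℕ}

/-! ## §1 The displayed binders transfer along a gauge transformation (general `E`) -/

section Binders

variable {E : Type*} [NormedAddCommGroup E] [InnerProductSpace ℂ E] [CompleteSpace E]
variable (n L : ℕ) [NeZero n] [NeZero L] (M : Fin d → ℕ) [hM : ∀ μ, NeZero (M μ)]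
variable {v : Tor M → (E →L[ℂ] E)} (hv : ∀ y, v y ∈ unitary (E →L[ℂ] E))
variable {u : Tor (fine n M) → (E →L[ℂ] E)} (hu : ∀ x, u x ∈ unitary (E →L[ℂ] E))
variable {u' : Tor (fine L (fine n M)) → (E →L[ℂ] E)} (hu' : ∀ x, u' x ∈ unitary (E →L[ℂ] E))
variable {R : Tor (fine n M) → Fin d → (E →L[ℂ] E)} {T : Tor M → (Fin d → Fin n) → Fin n → Fin d → (E →L[ℂ] E)}
variable {G Gu : (Tor (fine n M) → Fin d → E) → ℝ} (hG : ∀ W, Gu (gaugeW (fine n M) u W) = G W)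
variable {R' : Tor (fine L (fine n M)) → Fin d → (E →L[ℂ] E)} {T' : Tor (fine n M) → (Fin d → Fin L) → Fin L → Fin d → (E →L[ℂ] E)}
variable {G' Gu' : (Tor (fine L (fine n M)) → Fin d → E) → ℝ} (hG' : ∀ W', Gu' (gaugeW (fine L (fine n M)) u' W') = G' W')

/-- adjoint site fields are unitary. [folklore] -/
theorem star_unitary {ι : Type*} {w : ι → (E →L[ℂ] E)} (hw : ∀ x, w x ∈ unitary (E →L[ℂ] E)) (x : ι) :
    (fun x => star (w x)) x ∈ unitary (E →L[ℂ] E) := Unitary.star_mem (hw x)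

include hv hu hG

omit [NeZero L] in
/-- **V-UB TRANSFERS**: `(∀ φ, ∃ W, Q_T W = φ ∧ ScV R G W ≤ Λ‖φ‖²) → (∀ φ, ∃ W, Q_{T^g} W = φ ∧ ScV R^u G^u W ≤ Λ‖φ‖²)`. [folklore] -/
theorem hUBc_gauge {Λ : ℝ} (hUBc : ∀ φ : Tor M → Fin d → E, ∃ W, QvL n M T W = φ ∧ ScV n M R G W ≤ Λ * nsqV M φ) (φ : Tor M → Fin d → E) :
    ∃ W, QvL n M (gaugeL n M v u T) W = φ ∧ ScV n M (gaugeR (fine n M) u R) Gu W ≤ Λ * nsqV M φ := by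
  obtain ⟨W₀, hW₀, hS₀⟩ := hUBc (gaugeW M (fun y => star (v y)) φ)
  refine ⟨gaugeW (fine n M) u W₀, ?_, ?_⟩
  · rw [QvL_gauge n M hu, hW₀, gaugeW_gaugeW_star hv]
  · rw [ScV_gauge n M hu R hG]
    rwa [nsqV_gauge (star_unitary hv)] at hS₀

omit [NeZero L] in
/-- **V-P TRANSFERS**: `(∀ W, qWV W ≤ C_P(ScV R G W + ‖Q_T W‖²)) → (∀ W, qWV W ≤ C_P(ScV R^u G^u W + ‖Q_{T^g} W‖²))`. [folklore] -/
theorem hPc_gauge {CP : ℝ} (hPc : ∀ W, qWV n M W ≤ CP * (ScV n M R G W + nsqV M (QvL n M T W))) (W : Tor (fine n M) → Fin d → E) :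
    qWV n M W ≤ CP * (ScV n M (gaugeR (fine n M) u R) Gu W + nsqV M (QvL n M (gaugeL n M v u T) W)) := by
  have h := hPc (gaugeW (fine n M) (fun x => star (u x)) W)
  rw [← gaugeW_gaugeW_star hu W, qWV_gauge n M hu, ScV_gauge n M hu R hG, QvL_gauge n M hu, nsqV_gauge hv]
  exact h

omit [NeZero L] in
/-- **(GF3) TRANSFERS**: the divergence-control binder of `VariationalVectorGarding` ∕ part 6 holds for the gauged data with the same constants. [folklore] -/
theorem hGdiv_gauge {CD CD' : ℝ}
    (hGdiv : ∀ W, ((n : ℝ) ^ d)⁻¹ * ((n : ℝ) ^ 2 * divSq (fine n M) R W) ≤ CD * ScV n M R G W + CD' * nsqV M (QvL n M T W)) (W : Tor (fine n M) → Fin d → E) :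
    ((n : ℝ) ^ d)⁻¹ * ((n : ℝ) ^ 2 * divSq (fine n M) (gaugeR (fine n M) u R) W)
      ≤ CD * ScV n M (gaugeR (fine n M) u R) Gu W + CD' * nsqV M (QvL n M (gaugeL n M v u T) W) := by
  have h := hGdiv (gaugeW (fine n M) (fun x => star (u x)) W)
  rw [← gaugeW_gaugeW_star hu W, divSq_gauge hu, ScV_gauge n M hu R hG, QvL_gauge n M hu, nsqV_gauge hv]
  exact h

omit [NeZero L] in
/-- fibres and minimisers correspond: `W` minimises the gauged form on `{Q_{T^g} · = φ}` iff `u⋆W` minimises the presented form on `{Q_T · = v⋆φ}`. [folklore] -/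
theorem isMin_gauge_iff (φ : Tor M → Fin d → E) (W : Tor (fine n M) → Fin d → E) :
    (QvL n M (gaugeL n M v u T) W = φ ∧ ∀ W₂, QvL n M (gaugeL n M v u T) W₂ = φ →
        ScV n M (gaugeR (fine n M) u R) Gu W ≤ ScV n M (gaugeR (fine n M) u R) Gu W₂)
      ↔ (QvL n M T (gaugeW (fine n M) (fun x => star (u x)) W) = gaugeW M (fun y => star (v y)) φ ∧
          ∀ W₂, QvL n M T W₂ = gaugeW M (fun y => star (v y)) φ →
            ScV n M R G (gaugeW (fine n M) (fun x => star (u x)) W) ≤ ScV n M R G W₂) := by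
  have hfib : ∀ W₂ : Tor (fine n M) → Fin d → E, QvL n M (gaugeL n M v u T) W₂ = φ ↔
      QvL n M T (gaugeW (fine n M) (fun x => star (u x)) W₂) = gaugeW M (fun y => star (v y)) φ := fun W₂ => by
    conv_lhs => rw [← gaugeW_gaugeW_star hu W₂, ← gaugeW_gaugeW_star hv φ]
    exact QvL_gauge_eq_iff n M hu hv T _ _
  have hval : ∀ W₂ : Tor (fine n M) → Fin d → E, ScV n M (gaugeR (fine n M) u R) Gu W₂ = ScV n M R G (gaugeW (fine n M) (fun x => star (u x)) W₂) :=
    fun W₂ => by conv_lhs => rw [← gaugeW_gaugeW_star hu W₂]; exact ScV_gauge n M hu R hG _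
  constructor
  · rintro ⟨hW, hmin⟩
    refine ⟨(hfib W).1 hW, fun W₂ hW₂ => ?_⟩
    have h2 : QvL n M (gaugeL n M v u T) (gaugeW (fine n M) u W₂) = φ := (hfib _).2 (by rwa [gaugeW_star_gaugeW hu])
    have h3 := hmin _ h2
    rwa [hval W, hval, gaugeW_star_gaugeW hu] at h3
  · rintro ⟨hW, hmin⟩
    refine ⟨(hfib W).2 hW, fun W₂ hW₂ => ?_⟩
    rw [hval W, hval W₂]
    exact hmin _ ((hfib W₂).1 hW₂)

omit [NeZero L] in
/-- **V-REG TRANSFERS** (`ρ = rhoV`): the regularity binder at constrained minimisers holds for the gauged data with the same constant. [folklore] -/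
theorem hREG_gauge {CR : ℝ}
    (hREG : ∀ (φ : Tor M → Fin d → E) W, QvL n M T W = φ → (∀ W₂, QvL n M T W₂ = φ → ScV n M R G W ≤ ScV n M R G W₂) →
      rhoV n M R W ≤ CR * (ScV n M R G W + nsqV M φ))
    (φ : Tor M → Fin d → E) (W : Tor (fine n M) → Fin d → E) (hW : QvL n M (gaugeL n M v u T) W = φ)
    (hmin : ∀ W₂, QvL n M (gaugeL n M v u T) W₂ = φ → ScV n M (gaugeR (fine n M) u R) Gu W ≤ ScV n M (gaugeR (fine n M) u R) Gu W₂) :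
    rhoV n M (gaugeR (fine n M) u R) W ≤ CR * (ScV n M (gaugeR (fine n M) u R) Gu W + nsqV M φ) := by
  obtain ⟨hW', hmin'⟩ := (isMin_gauge_iff n M hv hu hG φ W).1 ⟨hW, hmin⟩
  have h := hREG _ _ hW' hmin'
  rw [nsqV_gauge (star_unitary hv)] at h
  rw [← gaugeW_gaugeW_star hu W, rhoV_gauge n M hu, ScV_gauge n M hu R hG]
  exact h

include hu' hG'

/-- **(ONE-min) TRANSFERS**: leaf V-ONE at coarse minimisers into the composite fibre holds for the gauged two-level data `(R^u, T^g, G^u ; R′^{u′}, T′^g, G′^{u′})`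
with the same `ε₁`, `δ′` (`ρ = rhoV`). [folklore] -/
theorem hONEm_gauge {ε₁ δ' : ℝ}
    (hONEm : ∀ (φ : Tor M → Fin d → E) (W₀ : Tor (fine n M) → Fin d → E), QvL n M T W₀ = φ →
      (∀ W, QvL n M T W = φ → ScV n M R G W₀ ≤ ScV n M R G W) →
      ∃ g, QvL n M T (QvL L (fine n M) T' g) = φ ∧ SfV n L M R' G' g ≤ (Real.sqrt (ScV n M R G W₀ + ε₁ * rhoV n M R W₀) + δ' * Real.sqrt (qWV n M W₀)) ^ 2)
    (φ : Tor M → Fin d → E) (W₀ : Tor (fine n M) → Fin d → E) (hW₀ : QvL n M (gaugeL n M v u T) W₀ = φ)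
    (hmin : ∀ W, QvL n M (gaugeL n M v u T) W = φ → ScV n M (gaugeR (fine n M) u R) Gu W₀ ≤ ScV n M (gaugeR (fine n M) u R) Gu W) :
    ∃ g, QvL n M (gaugeL n M v u T) (QvL L (fine n M) (gaugeL L (fine n M) u u' T') g) = φ ∧
      SfV n L M (gaugeR (fine L (fine n M)) u' R') Gu' g
        ≤ (Real.sqrt (ScV n M (gaugeR (fine n M) u R) Gu W₀ + ε₁ * rhoV n M (gaugeR (fine n M) u R) W₀) + δ' * Real.sqrt (qWV n M W₀)) ^ 2 := by
  obtain ⟨hW', hmin'⟩ := (isMin_gauge_iff n M hv hu hG φ W₀).1 ⟨hW₀, hmin⟩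
  obtain ⟨g₁, hg₁, hS₁⟩ := hONEm _ _ hW' hmin'
  refine ⟨gaugeW (fine L (fine n M)) u' g₁, ?_, ?_⟩
  · rw [QvL_gauge L (fine n M) hu', QvL_gauge n M hu, hg₁, gaugeW_gaugeW_star hv]
  · rw [SfV_gauge n L M hu' R' hG']
    rw [← gaugeW_gaugeW_star hu W₀, rhoV_gauge n M hu, ScV_gauge n M hu R hG, qWV_gauge n M hu]
    exact hS₁

end Binders

/-! ## §2 `E = ℂ`: the block-spin values are invariant and the monotone END's conclusion transfers along the orbit -/

section Transfer

variable (n : ℕ) [NeZero n] (M : Fin d → ℕ) [hM : ∀ μ, NeZero (M μ)]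
variable {v : Tor M → (ℂ →L[ℂ] ℂ)} (hv : ∀ y, v y ∈ unitary (ℂ →L[ℂ] ℂ))
variable {u : Tor (fine n M) → (ℂ →L[ℂ] ℂ)} (hu : ∀ x, u x ∈ unitary (ℂ →L[ℂ] ℂ))
include hv hu

/-- **THE BLOCK-SPIN VALUES ARE GAUGE-INVARIANT**: `blockSpin (QvL T^g) (ScV R^u G^u) (v·φ) = blockSpin (QvL T) (ScV R G) φ` (the rotations are bijections of the
fibres preserving the action; `blockSpin_relabel`). [folklore] -/
theorem blockSpin_gauge (R : Tor (fine n M) → Fin d → (ℂ →L[ℂ] ℂ)) (T : Tor M → (Fin d → Fin n) → Fin n → Fin d → (ℂ →L[ℂ] ℂ))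
    {G Gu : (Tor (fine n M) → Fin d → ℂ) → ℝ} (hG : ∀ W, Gu (gaugeW (fine n M) u W) = G W) (φ : Tor M → Fin d → ℂ) :
    blockSpin (QvL n M (gaugeL n M v u T)) (ScV n M (gaugeR (fine n M) u R) Gu) (gaugeW M v φ) = blockSpin (QvL n M T) (ScV n M R G) φ :=
  blockSpin_relabel (Equiv.ofBijective _ (gaugeW_bijective hu)) (Equiv.ofBijective _ (gaugeW_bijective hv))
    (fun W => QvL_gauge n M hu T W) (fun W => ScV_gauge n M hu R hG W) φ

omit [NeZero n] hv hu in
/-- `unc (v·φ) = V *ᵥ unc φ` read in forms: `qform X (unc (v·φ)) = qform (Vᴴ X V) (unc φ)`. [folklore] -/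
theorem qform_unc_gaugeW (X : Matrix (Tor M × Fin d) (Tor M × Fin d) ℂ) (φ : Tor M → Fin d → ℂ) :
    qform X (unc (gaugeW M v φ)) = qform ((phaseM M v)ᴴ * X * phaseM M v) (unc φ) := by
  have h := qform_conj ((phaseM M v)ᴴ) X (unc φ)
  rw [star_eq_conjTranspose, conjTranspose_conjTranspose] at h
  rw [h, unc_gaugeW]

end Transfer

section Tower

variable (L : ℕ) [NeZero L] (M : Fin d → ℕ) [hM : ∀ μ, NeZero (M μ)]
variable {v : Tor M → (ℂ →L[ℂ] ℂ)} (hv : ∀ y, v y ∈ unitary (ℂ →L[ℂ] ℂ))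
variable {u : (k : ℕ) → Tor (fine (L ^ k) M) → (ℂ →L[ℂ] ℂ)} (hu : ∀ k x, u k x ∈ unitary (ℂ →L[ℂ] ℂ))
variable (R : (k : ℕ) → Tor (fine (L ^ k) M) → Fin d → (ℂ →L[ℂ] ℂ))
variable (Gm : (k : ℕ) → Matrix (Tor (fine (L ^ k) M) × Fin d) (Tor (fine (L ^ k) M) × Fin d) ℂ)
variable (G Gu : (k : ℕ) → (Tor (fine (L ^ k) M) → Fin d → ℂ) → ℝ)
variable (T : (k : ℕ) → Tor M → (Fin d → Fin (L ^ k)) → Fin (L ^ k) → Fin d → (ℂ →L[ℂ] ℂ))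
include hv hu

/-- **THE GAUGE-ORBIT TRANSFER OF THE MONOTONE END's CONCLUSION.**  Along ANY unitary site fields `u k` (level `k`) and `v` (unit lattice): if the effective operators of
the GAUGED tower `effV (L^k) M (R^u k) (U_k Gm_k U_kᴴ) (QmL (T^g k)) a` converge to a Hermitian `X∞` with nonnegative form and the gauged block-spin values converge to its
form, then the PRESENTED tower's effective operators converge to `Vᴴ X∞ V`, Hermitian with nonnegative form, and its block-spin values converge to that form — the
conclusion of `VariationalVectorEndMonotone.effV_tendsto_of_upper` ∕ `…_of_bracket` ∕ part 6, verbatim.  No coherence of the `u k` is used. [folklore] -/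
theorem effV_limit_of_gauge (hG : ∀ k W, Gu k (gaugeW (fine (L ^ k) M) (u k) W) = G k W) {a : ℝ}
    (h : ∃ Xlim : Matrix (Tor M × Fin d) (Tor M × Fin d) ℂ,
      Tendsto (fun k => effV (L ^ k) M (gaugeR (fine (L ^ k) M) (u k) (R k))
        (phaseM (fine (L ^ k) M) (u k) * Gm k * (phaseM (fine (L ^ k) M) (u k))ᴴ) (QmL (L ^ k) M (gaugeL (L ^ k) M v (u k) (T k))) a) atTop (𝓝 Xlim) ∧
      Xlim.IsHermitian ∧ (∀ w, 0 ≤ qform Xlim w) ∧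
      ∀ φ : Tor M → Fin d → ℂ, Tendsto (fun k => blockSpin (QvL (L ^ k) M (gaugeL (L ^ k) M v (u k) (T k)))
        (ScV (L ^ k) M (gaugeR (fine (L ^ k) M) (u k) (R k)) (Gu k)) φ) atTop (𝓝 (qform Xlim (unc φ)))) :
    ∃ Xlim : Matrix (Tor M × Fin d) (Tor M × Fin d) ℂ,
      Tendsto (fun k => effV (L ^ k) M (R k) (Gm k) (QmL (L ^ k) M (T k)) a) atTop (𝓝 Xlim) ∧ Xlim.IsHermitian ∧ (∀ w, 0 ≤ qform Xlim w) ∧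
      ∀ φ : Tor M → Fin d → ℂ, Tendsto (fun k => blockSpin (QvL (L ^ k) M (T k)) (ScV (L ^ k) M (R k) (G k)) φ) atTop (𝓝 (qform Xlim (unc φ))) := by
  obtain ⟨X, hT, hH, hnn, hform⟩ := h
  have hV := phaseM_conjTranspose_mul hv
  have hV' := phaseM_mul_conjTranspose hv
  -- the presented effective operators are the conjugates `Vᴴ · (gauged) · V`
  have heff : ∀ k, effV (L ^ k) M (R k) (Gm k) (QmL (L ^ k) M (T k)) a
      = (phaseM M v)ᴴ * effV (L ^ k) M (gaugeR (fine (L ^ k) M) (u k) (R k)) (phaseM (fine (L ^ k) M) (u k) * Gm k * (phaseM (fine (L ^ k) M) (u k))ᴴ)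
          (QmL (L ^ k) M (gaugeL (L ^ k) M v (u k) (T k))) a * phaseM M v := fun k => by
    rw [effV_gauge (L ^ k) M hv (hu k)]
    simp only [Matrix.mul_assoc]
    rw [hV, Matrix.mul_one, ← Matrix.mul_assoc, hV, Matrix.one_mul]
  refine ⟨(phaseM M v)ᴴ * X * phaseM M v, ?_, isHermitian_conjTranspose_mul_mul _ hH, fun w => ?_, fun φ => ?_⟩
  · have hc : Tendsto (fun k => (phaseM M v)ᴴ * effV (L ^ k) M (gaugeR (fine (L ^ k) M) (u k) (R k))
        (phaseM (fine (L ^ k) M) (u k) * Gm k * (phaseM (fine (L ^ k) M) (u k))ᴴ) (QmL (L ^ k) M (gaugeL (L ^ k) M v (u k) (T k))) a * phaseM M v)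
        atTop (𝓝 ((phaseM M v)ᴴ * X * phaseM M v)) := (hT.const_mul _).mul_const _
    refine hc.congr fun k => (heff k).symm
  · have hq := qform_conj ((phaseM M v)ᴴ) X w
    rw [star_eq_conjTranspose, conjTranspose_conjTranspose] at hq
    rw [hq]; exact hnn _
  · have e : (fun k => blockSpin (QvL (L ^ k) M (T k)) (ScV (L ^ k) M (R k) (G k)) φ)
        = fun k => blockSpin (QvL (L ^ k) M (gaugeL (L ^ k) M v (u k) (T k))) (ScV (L ^ k) M (gaugeR (fine (L ^ k) M) (u k) (R k)) (Gu k)) (gaugeW M v φ) :=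
      funext fun k => (blockSpin_gauge (L ^ k) M hv (hu k) (R k) (T k) (hG k) φ).symm
    rw [e, ← qform_unc_gaugeW M]
    exact hform _

end Tower

end Summit.QuantumFields.BalabanUV.T4Continuum.VectorGaugeCovariance

end
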